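/-
Copyright: the b2b-balaban T⁴-continuum CRUX team, row NE7b leaf lineage `t4-ne7b-formalise-leaf-02` (gen 134). Project licence.
-/
import Summits.QuantumFields.BalabanUV.T4Continuum.Spine.NE7b.TentUnityTorusSupport
import Mathlib.Analysis.SpecialFunctions.Trigonometric.Bounds

/-!
# THE SINE OF THE CITED TENT IS A QUADRATIC PARTITION OF UNITY ON THE CIRCLE: `g_b(a) := sin(π∕2 · h(a − (bL + c)))` has `Σ_b g_b(a)² = 1` EXACTLY
# (the two alive tents at a site sum to one, and `sin²(πθ∕2) + sin²(π(1−θ)∕2) = 1`), values in `[0, 1]`, the SAME alive pair as the tent, and moves by at most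
# `π∕(2L)` per lattice step — print's «quadratic partition `Σ_□h_□² = 1`, `|h_□(b) − h_□(b′)| ≤ c_h|b − b′|∕M`» of [B6] Sect. A built from the (3.40) tent
# WITHOUT normalisation (row NE7b, node U5c; residual (R2′) family (2), letter (ℓ1); kernel lemmas over a cited Literature object)

Cell `pub-balaban`, sub-cell `t4`, spine estimate NE7b (`T4WeightBudget.RelWeightBound`; the cell's OWN estimate — NOT PRINTED in [Bałaban 1983–89],
NOT PROVED).  Crux-route work under `Spine/NE7b/`; NOTHING of Bałaban's estimates is asserted; no `def`; zero `sorry`; no `T4Continuum/Support` leaf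
(FREEZE (0)).  Imports: this lineage's `…TentUnityTorusSupport` (TUS: the alive pair `filter_tentZ_ne_zero_subset_pair` ∕ `…_add_one_subset_pair`,
`tentZ_le_one`; through it leaf-05's `…TentUnityTorusSteps` `abs_tentZ_add_one_sub_le` and the cited `B14TentUnityTorus.tentZ` ∕ `sum_tentZ_sub_eq_one`)
and Mathlib's `Real.abs_sin_sub_sin_le` (`sin` is 1-Lipschitz).

WHY.  The (h2) slot's IMS floor `…AdmissibleFloorSeminormTerms.ims_floor_of_linear_terms` (AFST) wants a QUADRATIC partition `Σ_s h_s(c)² = 1` with a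
pointwise Lipschitz letter `λ` and a term multiplicity `μ`, and prices the localisation by `ε = μℓ²λ²ab`.  The route through the LINEAR tent (TPC ∕ TPP ∕ TZS ∕ TUS
∕ PPaL ∕ TPTo) normalises `φ ↦ φ∕‖φ‖₂` (QPU ∕ AFLP), which costs `(2√μ₀)² = 4·2^d` in `λ²`; print's `{h_□}` is quadratic from the start.  The sine of the tent
is the standard quadratic partition subordinate to the same cubes: THIS FILE proves its one-axis letters; `…SineTentQuadraticPartition` takes the product over
the axes and `…SineTentFloor` feeds AFST — `λ = Dπ∕(2L)` instead of `2√(2^d)·D√2∕L` (d = 4 plaquette terms: `E·L² ≈ 947` instead of `49 152`).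

WHAT IS PROVED ([folklore]; `0 < L`, `N = M·L`, centres `(b.val·L + c : ℕ)`, `θ_b(a) := tentZ L (a − (b.val·L + c))`, `g_b(a) := sin(π∕2·θ_b(a))` written out):
* §1 `sin_tent_nonneg`, `sin_tent_le_one`, **`sin_tent_eq_zero_iff`** (`g_b(a) = 0 ↔ θ_b(a) = 0`: `θ ∈ [0,1]` and `sin > 0` on `(0, π)`).
* §2 `filter_sin_tent_ne_zero_eq` (the alive set of `g` IS the alive set of `θ`), hence `filter_sin_tent_ne_zero_subset_pair`,
  `filter_sin_tent_ne_zero_add_one_subset_pair` (`2 ≤ M`), `card_alive_sin_tent_le_two` — TUS BY NAME.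
* §3 **`sum_sq_sin_tent_eq_one`** (`2 ≤ M`): `Σ_b g_b(a)² = 1` — the sum lives on the pair `{q̄, q̄+1}` (`q̄ ≠ q̄ + 1` as `2 ≤ M`), the two tents there sum to
  `Σ_b θ_b(a) = 1` (`sum_tentZ_sub_eq_one`), and `sin²(πθ∕2) + sin²(π(1−θ)∕2) = sin² + cos² = 1` (`Real.sin_pi_div_two_sub`).
* §4 **`abs_sin_tent_add_one_sub_le`** (`2 ≤ N`): `|g_b(a+1) − g_b(a)| ≤ π∕(2L)` (`Real.abs_sin_sub_sin_le` ∘ TZS `abs_tentZ_add_one_sub_le`).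
* §5 toy: `M = 2`, `L = 1`: `Σ_b g_b(a)² = 1` on `ℤ∕2ℤ` (`example` via §3).

NOT HERE (honest): the product over the axes, chains, the AFST junction (`…SineTentQuadraticPartition`, `…SineTentFloor`); anything of Bałaban's estimates.
BY-NAME EFFECT ON THE WALL: NONE.  NE7b NOT PRINTED ∕ NOT PROVED; spine PROVED 0∕9; rung (B)+1 on ONE finite T⁴ — NOT infinite volume, NOT the mass gap, NOT Clay.
HONEST DEPENDENCY: continuum YM on T⁴ ⇐ BetaPertH ∧ nine spine estimates (0/9 proved); BetaPertH ⇐ (D1) ∧ (D4) ∧ CAP+tail; G-an2-4 gates asym, D1 and NE2/3/4.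
-/

set_option autoImplicit false

noncomputable section

open Finset
open Literature.MathematicalPhysics.QuantumFieldTheory.Balaban1983to89.B14.TentUnityTorus (tentZ tentZ_nonneg sum_tentZ_sub_eq_one)
open Summit.QuantumFields.BalabanUV.T4Continuum.NE7b.TentUnityTorusSteps (abs_tentZ_add_one_sub_le)
open Summit.QuantumFields.BalabanUV.T4Continuum.NE7b.TentUnityTorusSupport (tentZ_le_one filter_tentZ_ne_zero_subset_pair
  filter_tentZ_ne_zero_add_one_subset_pair)

namespace Summit.QuantumFields.BalabanUV.T4Continuum.NE7b.SineTentAxis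

/-! ## §1 Values in `[0, 1]`; the sine vanishes exactly where the tent does -/

/-- `0 ≤ sin(π∕2·θ)` for the tent value `θ ∈ [0, 1]`. [folklore] -/
theorem sin_tent_nonneg {L : ℝ} (hL : 0 < L) {N : ℕ} (u : ZMod N) : 0 ≤ Real.sin (Real.pi / 2 * tentZ L u) := by
  have h0 := tentZ_nonneg L u
  have h1 := tentZ_le_one hL u
  exact Real.sin_nonneg_of_nonneg_of_le_pi (by positivity) (by nlinarith [Real.pi_pos])

/-- `sin(π∕2·θ) ≤ 1`. [folklore] -/
theorem sin_tent_le_one (L : ℝ) {N : ℕ} (u : ZMod N) : Real.sin (Real.pi / 2 * tentZ L u) ≤ 1 := Real.sin_le_one _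

/-- **`sin(π∕2·θ) = 0 ↔ θ = 0`** for the tent value `θ ∈ [0, 1]` (`sin > 0` on `(0, π)`). [folklore] -/
theorem sin_tent_eq_zero_iff {L : ℝ} (hL : 0 < L) {N : ℕ} (u : ZMod N) : Real.sin (Real.pi / 2 * tentZ L u) = 0 ↔ tentZ L u = 0 := by
  constructor
  · intro h
    by_contra hne
    have hpos : 0 < tentZ L u := lt_of_le_of_ne (tentZ_nonneg L u) (Ne.symm hne)
    have h1 := tentZ_le_one hL u
    have : 0 < Real.sin (Real.pi / 2 * tentZ L u) :=
      Real.sin_pos_of_pos_of_lt_pi (by positivity) (by nlinarith [Real.pi_pos])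
    linarith
  · intro h; rw [h, mul_zero, Real.sin_zero]

/-! ## §2 The alive set of the sine is the alive set of the tent -/

/-- The alive cubes of `g` are the alive cubes of `θ`. [folklore] -/
theorem filter_sin_tent_ne_zero_eq (L M N : ℕ) [NeZero M] (hL : 0 < L) (c : ℕ) (a : ZMod N) :
    (Finset.univ.filter fun b : ZMod M => Real.sin (Real.pi / 2 * tentZ (L : ℝ) (a - ((b.val * L + c : ℕ) : ZMod N))) ≠ 0)
      = Finset.univ.filter fun b : ZMod M => tentZ (L : ℝ) (a - ((b.val * L + c : ℕ) : ZMod N)) ≠ 0 := by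
  have hLr : (0 : ℝ) < L := by exact_mod_cast hL
  refine Finset.filter_congr fun b _ => ?_
  exact not_congr (sin_tent_eq_zero_iff hLr _)

/-- The alive cubes of `g` at `a` lie in the tent's pair `{q̄, q̄ + 1}`, `q = (a − c).val ∕ L` (TUS `filter_tentZ_ne_zero_subset_pair`). [folklore] -/
theorem filter_sin_tent_ne_zero_subset_pair (L M N : ℕ) [NeZero M] [NeZero N] (hL : 0 < L) (hN : N = M * L) (c : ℕ) (a : ZMod N) :
    (Finset.univ.filter fun b : ZMod M => Real.sin (Real.pi / 2 * tentZ (L : ℝ) (a - ((b.val * L + c : ℕ) : ZMod N))) ≠ 0)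
      ⊆ {(((a - (c : ZMod N)).val / L : ℕ) : ZMod M), (((a - (c : ZMod N)).val / L : ℕ) : ZMod M) + 1} := by
  rw [filter_sin_tent_ne_zero_eq L M N hL c a]
  exact filter_tentZ_ne_zero_subset_pair L M N hL hN c a

/-- The alive cubes of `g` at `a + 1` lie in the pair OF `a` (TUS `filter_tentZ_ne_zero_add_one_subset_pair`; `2 ≤ M`). [folklore] -/
theorem filter_sin_tent_ne_zero_add_one_subset_pair (L M N : ℕ) [NeZero M] [NeZero N] (hL : 0 < L) (hM : 2 ≤ M) (hN : N = M * L) (c : ℕ)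
    (a : ZMod N) :
    (Finset.univ.filter fun b : ZMod M => Real.sin (Real.pi / 2 * tentZ (L : ℝ) (a + 1 - ((b.val * L + c : ℕ) : ZMod N))) ≠ 0)
      ⊆ {(((a - (c : ZMod N)).val / L : ℕ) : ZMod M), (((a - (c : ZMod N)).val / L : ℕ) : ZMod M) + 1} := by
  rw [filter_sin_tent_ne_zero_eq L M N hL c (a + 1)]
  exact filter_tentZ_ne_zero_add_one_subset_pair L M N hL hM hN c a

/-- At most two cubes alive at a site for the sine partition. [folklore] -/
theorem card_alive_sin_tent_le_two (L M N : ℕ) [NeZero M] [NeZero N] (hL : 0 < L) (hN : N = M * L) (c : ℕ) (a : ZMod N) :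
    (Finset.univ.filter fun b : ZMod M => Real.sin (Real.pi / 2 * tentZ (L : ℝ) (a - ((b.val * L + c : ℕ) : ZMod N))) ≠ 0).card ≤ 2 :=
  (Finset.card_le_card (filter_sin_tent_ne_zero_subset_pair L M N hL hN c a)).trans ((Finset.card_insert_le _ _).trans (by simp))

/-! ## §3 The squares sum to one -/

/-- **`Σ_b sin(π∕2·θ_b(a))² = 1`** (`0 < L`, `2 ≤ M`, `N = M·L`): the sum lives on the pair `{q̄, q̄+1}` (two distinct cubes as `2 ≤ M`), the two tents there sum
to `Σ_b θ_b(a) = 1` (`sum_tentZ_sub_eq_one`), and `sin²(πθ∕2) + sin²(π(1−θ)∕2) = sin²(πθ∕2) + cos²(πθ∕2) = 1`. [folklore] -/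
theorem sum_sq_sin_tent_eq_one (L M N : ℕ) [NeZero M] [NeZero N] (hL : 0 < L) (hM : 2 ≤ M) (hN : N = M * L) (c : ℕ) (a : ZMod N) :
    ∑ b : ZMod M, Real.sin (Real.pi / 2 * tentZ (L : ℝ) (a - ((b.val * L + c : ℕ) : ZMod N))) ^ 2 = 1 := by
  classical
  have hLr : (0 : ℝ) < L := by exact_mod_cast hL
  set q : ZMod M := (((a - (c : ZMod N)).val / L : ℕ) : ZMod M) with hq
  -- the pair has two distinct elements
  have hne : q ≠ q + 1 := by
    intro h
    have h1 : (1 : ZMod M) = 0 := by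
      have := congrArg (fun z => z - q) h
      simpa using this.symm
    haveI : Fact (1 < M) := ⟨by omega⟩
    exact one_ne_zero h1
  -- both sums live on the pair
  have hvanT : ∀ b, b ∉ ({q, q + 1} : Finset (ZMod M)) → tentZ (L : ℝ) (a - ((b.val * L + c : ℕ) : ZMod N)) = 0 := by
    intro b hb
    by_contra hne0
    exact hb (filter_tentZ_ne_zero_subset_pair L M N hL hN c a (Finset.mem_filter.mpr ⟨Finset.mem_univ _, hne0⟩))
  have hsumT : tentZ (L : ℝ) (a - ((q.val * L + c : ℕ) : ZMod N)) + tentZ (L : ℝ) (a - (((q + 1).val * L + c : ℕ) : ZMod N)) = 1 := by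
    rw [← sum_tentZ_sub_eq_one L M hL hM N hN c a, ← Finset.sum_subset (Finset.subset_univ ({q, q + 1} : Finset (ZMod M)))
      (fun b _ hb => hvanT b hb), Finset.sum_pair hne]
  rw [← Finset.sum_subset (Finset.subset_univ ({q, q + 1} : Finset (ZMod M))) (fun b _ hb => by
      rw [(sin_tent_eq_zero_iff hLr _).mpr (hvanT b hb), zero_pow two_ne_zero]), Finset.sum_pair hne]
  -- `sin²(πθ∕2) + sin²(π(1−θ)∕2) = 1`
  set θ := tentZ (L : ℝ) (a - ((q.val * L + c : ℕ) : ZMod N)) with hθ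
  have hθ' : tentZ (L : ℝ) (a - (((q + 1).val * L + c : ℕ) : ZMod N)) = 1 - θ := by linarith
  rw [hθ', show Real.pi / 2 * (1 - θ) = Real.pi / 2 - Real.pi / 2 * θ by ring, Real.sin_pi_div_two_sub, Real.sin_sq_add_cos_sq]

/-! ## §4 One lattice step moves the sine by at most `π∕(2L)` -/

/-- **`|g_b(a+1) − g_b(a)| ≤ π∕(2L)`** (`0 < L`, `2 ≤ N`): `sin` is 1-Lipschitz and the tent moves by at most `1∕L` (TZS `abs_tentZ_add_one_sub_le`). [folklore] -/
theorem abs_sin_tent_add_one_sub_le {L : ℝ} (hL : 0 < L) {N : ℕ} (hN : 2 ≤ N) (u : ZMod N) :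
    |Real.sin (Real.pi / 2 * tentZ L (u + 1)) - Real.sin (Real.pi / 2 * tentZ L u)| ≤ Real.pi / (2 * L) := by
  refine (Real.abs_sin_sub_sin_le _ _).trans ?_
  rw [← mul_sub, abs_mul, abs_of_pos (by positivity : (0 : ℝ) < Real.pi / 2)]
  calc Real.pi / 2 * |tentZ L (u + 1) - tentZ L u| ≤ Real.pi / 2 * (1 / L) :=
        mul_le_mul_of_nonneg_left (abs_tentZ_add_one_sub_le hL hN u) (by positivity)
    _ = Real.pi / (2 * L) := by ring

/-- … in the centred indexing: `|g_b(a + 1) − g_b(a)| ≤ π∕(2L)` for the cube `b` (`a + 1 − x_b = (a − x_b) + 1`). [folklore] -/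
theorem abs_sin_tent_step_le (L M N : ℕ) (hL : 0 < L) (hN : 2 ≤ N) (c : ℕ) (a : ZMod N) (b : ZMod M) :
    |Real.sin (Real.pi / 2 * tentZ (L : ℝ) (a + 1 - ((b.val * L + c : ℕ) : ZMod N)))
        - Real.sin (Real.pi / 2 * tentZ (L : ℝ) (a - ((b.val * L + c : ℕ) : ZMod N)))| ≤ Real.pi / (2 * L) := by
  have heq : a + 1 - ((b.val * L + c : ℕ) : ZMod N) = a - ((b.val * L + c : ℕ) : ZMod N) + 1 := by ring
  rw [heq]
  exact abs_sin_tent_add_one_sub_le (by exact_mod_cast hL) hN _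

/-! ## §5 Toy: two cubes of one site -/

/- `M = 2`, `L = 1`, `N = 2`, `c = 0`: the squares of the sines sum to one at every site of `ℤ∕2ℤ`. -/
example (a : ZMod 2) : ∑ b : ZMod 2, Real.sin (Real.pi / 2 * tentZ ((1 : ℕ) : ℝ) (a - ((b.val * 1 + 0 : ℕ) : ZMod 2))) ^ 2 = 1 :=
  sum_sq_sin_tent_eq_one 1 2 2 one_pos le_rfl rfl 0 a

end Summit.QuantumFields.BalabanUV.T4Continuum.NE7b.SineTentAxis

end
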